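import Mathlib
import Literature.Analysis.FunctionSpaces.TorusFluidGlueProofs
import Literature.Analysis.FunctionSpaces.TorusLinearisedFormTruncation
import Literature.Analysis.FluidPDE.CheskidovAssemblyTools
import HarnessLib

/-!
# The rebuild floor of forced Navier–Stokes on the torus: exponential approach to the absorbing radius
(profile-eng-4 g3, cell `ns-blowup`, GROUP B zone Z4, 2026-08-26)

HONEST FRAMING (human ruling D-0035): nothing here is a claim about Navier–Stokes blow-up.
WHAT THIS IS NOT: not NS blow-up evidence; not a statement about any tower, episode or orbit. It is
the elementary companion of the tree's absorbing ball
`Summit.NavierStokesRegularity.FluidComputer.ForcedEnergyBall.sqrt_integral_norm_sq_le_max`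
(`‖u(t)‖_{L²} ≤ max (‖u(a)‖_{L²}) (F/(4π²ν))`): INSIDE the ball the `L²` norm can approach the
absorbing radius `R_f := F/(4π²ν)` at most exponentially at the Stokes rate `4π²ν`. For a classical
solution `(u, p)` of `∂ₜu + (u·∇)u = νΔu − ∇p + f` on the unit torus `T^d = ℝ^d/ℤ^d` with mean-zero
velocity slices and `‖f(t)‖_{L²} ≤ F` on `[a, b]`, the energy balance
`dE/dt = −ν‖∇u‖₂² + ∫⟪f, u⟫` (`Torus.IsClassicalNSSolutionOn.energy_balance_holds`), Poincaré
`4π²∫‖u‖² ≤ ‖∇u‖₂²` (`Torus.four_pi_sq_mul_integral_norm_sq_le_gradNormSq`) and Cauchy–Schwarz give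
`dE/dt ≤ L·(F − 4π²ν L)` with `L = ‖u(t)‖_{L²}`, `E = L²/2`; the exact barrier
`β(t) = R_f − (R_f − ‖u(a)‖)·e^{−4π²ν(t−a)}` solves `β' = 4π²ν(R_f − β)` and Mathlib's comparison
lemma `image_le_of_deriv_right_le_deriv_boundary` fences `E ≤ β²/2`:

* `sqrt_integral_norm_sq_le_radius_sub_exp` — if `‖u(a)‖_{L²} ≤ R_f` then for every `t ∈ [a, b]`,
  `‖u(t)‖_{L²} ≤ R_f − (R_f − ‖u(a)‖_{L²})·exp(−4π²ν (t − a))`;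
* `radius_sub_mul_exp_le_radius_sub` — the same, written `(R_f − ‖u(a)‖)·e^{−4π²ν(t−a)} ≤ R_f − ‖u(t)‖`;
* `sqrt_integral_norm_sq_lt_radius` — if `‖u(a)‖ < R_f` then `‖u(t)‖ < R_f` on `[a, b]`: the absorbing
  radius is NEVER re-attained from inside in finite time;
* `log_le_four_pi_sq_mul_nu_mul_sub` — the REBUILD-TIME FLOOR: if `‖u(a)‖ < R_f` then
  `log ((R_f − ‖u(a)‖) / (R_f − ‖u(t)‖)) ≤ 4π²ν·(t − a)`, i.e. climbing from `L²`-level `‖u(a)‖` to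
  `‖u(t)‖` costs at least `(4π²ν)⁻¹·ln((R_f − ‖u(a)‖)/(R_f − ‖u(t)‖))`;
* `sqrt_integral_norm_sq_le_host_sub_exp` — the HOST form: if `‖f(t)‖_{L²} ≤ 4π²ν·R_U` (e.g. the forced
  ABC host `f = (4π²ν)•U`, `Torus.abcFlow`, `AbcForcedSteadyState.isSteadyNSState_abcFlow`, first
  Fourier shell, `R_U = ‖U‖_{L²}`) then `‖u(t)‖ ≤ R_U − (R_U − ‖u(a)‖)·e^{−4π²ν(t−a)}`;
* `three_hundred_mul_log_gt` — the two kernel-checked numbers used below (`300·ln(88.9) > 1247`,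
  `300·ln(889) > 1871`, via `ln 2 > 0.6931471803`).

MODEL READING (GROUP B zone Z4, PROFILE-SPEC v1.2 §6.3 A7 / (E2), lead RULING (bw)(3)(ii); a DESIGN-
DICTIONARY sentence for the `EpisodeBase` stub `host_preparation`, never an instance of it). In the cell's
code units (torus `[0, 2π)³`, host wavenumber 1, `f = νU_ABC`, `ν = 1/R`) the rate `4π²ν` of the unit
torus reads `ν = 1/R` per code time unit and `R_U = ‖U_ABC‖`. A7 printed the LINEAR floor
`d√(E/E_U)/dt ≤ 1/R` ⇒ «an orbit visiting `E_min` and `E_U` has `T ≥ (1 − √(E_min/E_U))·R`»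
(= 266.7 code = 73.5 T_h for the 1a-R300 record's collapse floor `E/E_U = 0.0123`). The theorems here
give the EXPONENTIAL floor `√(E/E_U)(t) ≤ 1 − (1 − √(E/E_U)(a))·e^{−(t−a)/R}`: rebuilding from
`√(E/E_U) = 0.111` to `0.99` takes `≥ R·ln(0.889/0.01) = 300·ln 88.9 ≥ 1 247` code units (`> 343 T_h`;
float value 1 346 = 371 T_h), to the record's pre-episode level `0.999` (`E/E_U = 0.998`) `≥ 300·ln 889
≥ 1 871` code (`> 515 T_h`; float 2 037 = 561 T_h), and the level `√(E/E_U) = 1` is re-attained by NO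
state other than the host itself (`sqrt_integral_norm_sq_lt_radius`). So no (pre-)periodic orbit of the
MODEL flow shorter than ≈ 370 T_h contains the record's episode one, and the Z4-b calibration orbit
(`T = 2.99 T_h`, `E/E_U ≡ 0.0556`) is 120× too short — the (bw)(3)(ii) negative with a decl name.
WHAT THE MODEL READING IS NOT: not NS (forced T³ flow, `f = νU_ABC` not Clay-class); the theorems
themselves are statements about EVERY classical forced Navier–Stokes solution on `T^d`.

Mathlib + Literature only; theorems only, no new definitions.
-/

noncomputable section

namespace Summit.NavierStokesRegularity.FluidComputer.ForcedEnergyRebuildFloor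

open Set Filter MeasureTheory Literature.Analysis.FunctionSpaces Literature.Analysis.FunctionSpaces.Torus
open scoped InnerProductSpace Topology

variable {d : Type*} [Fintype d] [DecidableEq d]

/-- **Scalar rebuild fence.** Let `E` be continuous on `[a, b]` with right derivatives `E'`, let
`0 < κ`, `0 ≤ L_a ≤ R`, `E a = L_a²/2`, and suppose the SLOPE CONDITION: whenever `E t = L²/2` with
`L ≥ 0` (`t ∈ [a, b)`), `E' t ≤ κ·L·(R − L)`. Then whenever `E t = L²/2` with `L ≥ 0` (`t ∈ [a, b]`),
`L ≤ R − (R − L_a)·e^{−κ(t−a)}`. (Comparison with the barriers `β_ε(t) = R + ε − (R − L_a)e^{−κ(t−a)}`,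
`B_ε = β_ε²/2`, which solve `β_ε' = κ(R + ε − β_ε)` and are crossed strictly; then `ε → 0`.) -/
theorem le_radius_sub_exp_of_slope {E E' : ℝ → ℝ} {a b κ R La : ℝ} (hκ : 0 < κ) (hLa : 0 ≤ La)
    (hLaR : La ≤ R) (hE : ContinuousOn E (Icc a b))
    (hE' : ∀ t ∈ Ico a b, HasDerivWithinAt E (E' t) (Ici t) t) (hEa : E a = 2⁻¹ * La ^ 2)
    (hslope : ∀ t ∈ Ico a b, ∀ L : ℝ, 0 ≤ L → E t = 2⁻¹ * L ^ 2 → E' t ≤ κ * L * (R - L)) :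
    ∀ t ∈ Icc a b, ∀ L : ℝ, 0 ≤ L → E t = 2⁻¹ * L ^ 2 →
      L ≤ R - (R - La) * Real.exp (-κ * (t - a)) := by
  intro t ht L hL0 hEL
  refine le_of_forall_pos_le_add fun ε hε => ?_
  -- the barrier `β` and `B = β·β/2`
  set β : ℝ → ℝ := fun s => R + ε - (R - La) * Real.exp (-κ * (s - a)) with hβdef
  have hβder : ∀ s, HasDerivAt β (κ * ((R - La) * Real.exp (-κ * (s - a)))) s := by
    intro s
    have h1 : HasDerivAt (fun x : ℝ => -κ * (x - a)) (-κ * 1) s :=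
      ((hasDerivAt_id s).sub_const a).const_mul (-κ)
    have h3 := ((h1.exp).const_mul (R - La)).const_sub (R + ε)
    exact h3.congr_deriv (by ring)
  have hBder : ∀ s, HasDerivAt (fun x => 2⁻¹ * (β x * β x))
      (β s * (κ * ((R - La) * Real.exp (-κ * (s - a))))) s := fun s =>
    (((hβder s).mul (hβder s)).const_mul 2⁻¹).congr_deriv (by ring)
  have hexp_le : ∀ s, a ≤ s → Real.exp (-κ * (s - a)) ≤ 1 := by
    intro s hs; rw [Real.exp_le_one_iff]; nlinarith
  have hβ_ge : ∀ s, a ≤ s → La + ε ≤ β s := by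
    intro s hs
    have h1 : (R - La) * Real.exp (-κ * (s - a)) ≤ (R - La) * 1 :=
      mul_le_mul_of_nonneg_left (hexp_le s hs) (by linarith)
    show La + ε ≤ R + ε - (R - La) * Real.exp (-κ * (s - a)); linarith
  have hβ_pos : ∀ s, a ≤ s → 0 < β s := fun s hs => by linarith [hβ_ge s hs]
  -- comparison
  have hBa : E a ≤ 2⁻¹ * (β a * β a) := by
    have hβa : β a = La + ε := by
      show R + ε - (R - La) * Real.exp (-κ * (a - a)) = La + ε
      rw [sub_self, mul_zero, Real.exp_zero]; ring
    rw [hEa, hβa]; nlinarith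
  have hbound : ∀ s ∈ Ico a b, E s = 2⁻¹ * (β s * β s) →
      E' s < β s * (κ * ((R - La) * Real.exp (-κ * (s - a)))) := by
    intro s hs hEB
    have h1 := hslope s hs (β s) (hβ_pos s hs.1).le (by rw [hEB]; ring)
    have h2 : (R - La) * Real.exp (-κ * (s - a)) = R + ε - β s := by
      show (R - La) * Real.exp (-κ * (s - a)) = R + ε - (R + ε - (R - La) * Real.exp (-κ * (s - a)))
      ring
    rw [h2]
    have h3 : 0 < β s * (κ * ε) := mul_pos (hβ_pos s hs.1) (mul_pos hκ hε)
    nlinarith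
  have hfence := image_le_of_deriv_right_lt_deriv_boundary hE hE' (B := fun x => 2⁻¹ * (β x * β x))
    hBa hBder hbound ht
  -- unwrap
  have h1 : L ^ 2 ≤ β t ^ 2 := by
    have : 2⁻¹ * L ^ 2 ≤ 2⁻¹ * (β t * β t) := by rw [← hEL]; exact hfence
    nlinarith
  have h2 : L ≤ β t := (pow_le_pow_iff_left₀ hL0 (hβ_pos t ht.1).le two_ne_zero).mp h1
  have h3 : β t = R - (R - La) * Real.exp (-κ * (t - a)) + ε := by
    show R + ε - (R - La) * Real.exp (-κ * (t - a)) = _; ring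
  linarith

/-- **Exponential approach to the absorbing radius (classical forced Navier–Stokes on `T^d`).** Let
`(u, p)` solve the forced Navier–Stokes system classically on `S × T^d`, `S` convex, `ν > 0`, with
mean-zero velocity slices and `‖f(t)‖_{L²} ≤ F` on `[a, b] ⊆ S`, and suppose `‖u(a)‖_{L²} ≤ R_f := F/(4π²ν)`.
Then for every `t ∈ [a, b]`, `‖u(t)‖_{L²} ≤ R_f − (R_f − ‖u(a)‖_{L²})·exp(−4π²ν (t − a))`. -/
theorem sqrt_integral_norm_sq_le_radius_sub_exp {S : Set ℝ} {ν : ℝ}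
    {f u : ℝ → UnitAddTorus d → EuclideanSpace ℝ d} {p : ℝ → UnitAddTorus d → ℝ}
    (h : IsClassicalNSSolutionOn S ν f u p) (hS : Convex ℝ S) (hν : 0 < ν) {a b F : ℝ}
    (hab : Icc a b ⊆ S) (h0 : ∀ t ∈ Icc a b, HasZeroMean (u t))
    (hf : ∀ t ∈ Icc a b, IsSmooth (f t))
    (hF : ∀ t ∈ Icc a b, Real.sqrt (∫ x, ‖f t x‖ ^ 2) ≤ F)
    (ha : Real.sqrt (∫ x, ‖u a x‖ ^ 2) ≤ F / (4 * Real.pi ^ 2 * ν)) :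
    ∀ t ∈ Icc a b, Real.sqrt (∫ x, ‖u t x‖ ^ 2) ≤
      F / (4 * Real.pi ^ 2 * ν) - (F / (4 * Real.pi ^ 2 * ν) - Real.sqrt (∫ x, ‖u a x‖ ^ 2)) *
        Real.exp (-(4 * Real.pi ^ 2 * ν) * (t - a)) := by
  intro t ht
  have hπν : 0 < 4 * Real.pi ^ 2 * ν := by positivity
  set κ : ℝ := 4 * Real.pi ^ 2 * ν with hκ
  set Rf : ℝ := F / κ with hRf
  set La : ℝ := Real.sqrt (∫ x, ‖u a x‖ ^ 2) with hLa
  have hLa0 : 0 ≤ La := Real.sqrt_nonneg _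
  have hFκ : F = κ * Rf := by rw [hRf]; field_simp
  -- the energy and its one-sided derivative from the energy balance
  set E : ℝ → ℝ := fun s => kineticEnergy (u s) with hEdef
  set E' : ℝ → ℝ := fun s => -ν * gradNormSq (u s) + ∫ x, ⟪f s x, u s x⟫_ℝ with hE'def
  have hder : ∀ s ∈ S, HasDerivWithinAt E (E' s) S s := fun s hs =>
    IsClassicalNSSolutionOn.energy_balance_holds h hS hs
  have hcont : ContinuousOn E (Icc a b) := fun s hs =>
    ((hder s (hab hs)).continuousWithinAt).mono hab
  have hE' : ∀ s ∈ Ico a b, HasDerivWithinAt E (E' s) (Ici s) s := fun s hs =>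
    (hder s (hab (Ico_subset_Icc_self hs))).mono_of_mem_nhdsWithin
      (mem_of_superset (Icc_mem_nhdsGE hs.2) ((Icc_subset_Icc_left hs.1).trans hab))
  have hIa : 0 ≤ ∫ x, ‖u a x‖ ^ 2 := integral_nonneg fun _ => sq_nonneg _
  have hEa : E a = 2⁻¹ * La ^ 2 := by
    show 2⁻¹ * ∫ x, ‖u a x‖ ^ 2 = 2⁻¹ * La ^ 2
    rw [hLa, Real.sq_sqrt hIa]
  -- the slope condition from Poincaré and Cauchy–Schwarz
  have hslope : ∀ s ∈ Ico a b, ∀ L : ℝ, 0 ≤ L → E s = 2⁻¹ * L ^ 2 → E' s ≤ κ * L * (Rf - L) := by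
    intro s hs L hL0 hEL
    have hsI : s ∈ Icc a b := Ico_subset_Icc_self hs
    have hus : IsSmooth (u s) := h.smooth_velocity.isSmooth_slice (hab hsI)
    have hI0 : 0 ≤ ∫ x, ‖u s x‖ ^ 2 := integral_nonneg fun _ => sq_nonneg _
    have hL2 : L ^ 2 = ∫ x, ‖u s x‖ ^ 2 := by
      have : 2⁻¹ * ∫ x, ‖u s x‖ ^ 2 = 2⁻¹ * L ^ 2 := hEL
      linarith
    have hLs : Real.sqrt (∫ x, ‖u s x‖ ^ 2) = L := by rw [← hL2, Real.sqrt_sq hL0]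
    -- Poincaré and Cauchy–Schwarz
    have hP : 4 * Real.pi ^ 2 * L ^ 2 ≤ gradNormSq (u s) := by
      rw [hL2]; exact four_pi_sq_mul_integral_norm_sq_le_gradNormSq hus (h0 s hsI)
    have hCS : ∫ x, ⟪f s x, u s x⟫_ℝ ≤ F * L := by
      have h1 := Literature.Analysis.FluidPDE.abs_integral_inner_le_sqrt_mul_sqrt
        ((hf s hsI).memLp 2) (hus.memLp 2)
      rw [hLs] at h1
      exact (le_abs_self _).trans (h1.trans (mul_le_mul_of_nonneg_right (hF s hsI) hL0))
    calc E' s = -ν * gradNormSq (u s) + ∫ x, ⟪f s x, u s x⟫_ℝ := rfl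
      _ ≤ -ν * (4 * Real.pi ^ 2 * L ^ 2) + F * L := by nlinarith [hP, hCS, hν]
      _ = κ * L * (Rf - L) := by rw [hFκ, hκ]; ring
  have key := le_radius_sub_exp_of_slope (R := Rf) hπν hLa0 ha hcont hE' hEa hslope t ht
    (Real.sqrt (∫ x, ‖u t x‖ ^ 2)) (Real.sqrt_nonneg _)
    (by show 2⁻¹ * ∫ x, ‖u t x‖ ^ 2 = _
        rw [Real.sq_sqrt (integral_nonneg fun _ => sq_nonneg _)])
  simpa [hRf, hκ, hLa] using key

/-- The same bound written as a lower bound on the remaining gap to the absorbing radius: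
`(R_f − ‖u(a)‖)·e^{−4π²ν(t−a)} ≤ R_f − ‖u(t)‖`. -/
theorem radius_sub_mul_exp_le_radius_sub {S : Set ℝ} {ν : ℝ}
    {f u : ℝ → UnitAddTorus d → EuclideanSpace ℝ d} {p : ℝ → UnitAddTorus d → ℝ}
    (h : IsClassicalNSSolutionOn S ν f u p) (hS : Convex ℝ S) (hν : 0 < ν) {a b F : ℝ}
    (hab : Icc a b ⊆ S) (h0 : ∀ t ∈ Icc a b, HasZeroMean (u t))
    (hf : ∀ t ∈ Icc a b, IsSmooth (f t))
    (hF : ∀ t ∈ Icc a b, Real.sqrt (∫ x, ‖f t x‖ ^ 2) ≤ F)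
    (ha : Real.sqrt (∫ x, ‖u a x‖ ^ 2) ≤ F / (4 * Real.pi ^ 2 * ν)) :
    ∀ t ∈ Icc a b, (F / (4 * Real.pi ^ 2 * ν) - Real.sqrt (∫ x, ‖u a x‖ ^ 2)) *
        Real.exp (-(4 * Real.pi ^ 2 * ν) * (t - a)) ≤
      F / (4 * Real.pi ^ 2 * ν) - Real.sqrt (∫ x, ‖u t x‖ ^ 2) := by
  intro t ht
  have := sqrt_integral_norm_sq_le_radius_sub_exp h hS hν hab h0 hf hF ha t ht
  linarith

/-- **The absorbing radius is never re-attained from inside.** Under the hypotheses of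
`sqrt_integral_norm_sq_le_radius_sub_exp`, if `‖u(a)‖_{L²} < R_f` then `‖u(t)‖_{L²} < R_f` for
every `t ∈ [a, b]`. (For the forced ABC host, `R_f = ‖U‖_{L²}`: no state other than the host itself
reaches the host's energy level in finite time from below.) -/
theorem sqrt_integral_norm_sq_lt_radius {S : Set ℝ} {ν : ℝ}
    {f u : ℝ → UnitAddTorus d → EuclideanSpace ℝ d} {p : ℝ → UnitAddTorus d → ℝ}
    (h : IsClassicalNSSolutionOn S ν f u p) (hS : Convex ℝ S) (hν : 0 < ν) {a b F : ℝ}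
    (hab : Icc a b ⊆ S) (h0 : ∀ t ∈ Icc a b, HasZeroMean (u t))
    (hf : ∀ t ∈ Icc a b, IsSmooth (f t))
    (hF : ∀ t ∈ Icc a b, Real.sqrt (∫ x, ‖f t x‖ ^ 2) ≤ F)
    (ha : Real.sqrt (∫ x, ‖u a x‖ ^ 2) < F / (4 * Real.pi ^ 2 * ν)) :
    ∀ t ∈ Icc a b, Real.sqrt (∫ x, ‖u t x‖ ^ 2) < F / (4 * Real.pi ^ 2 * ν) := by
  intro t ht
  have h1 := radius_sub_mul_exp_le_radius_sub h hS hν hab h0 hf hF ha.le t ht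
  have h2 : 0 < (F / (4 * Real.pi ^ 2 * ν) - Real.sqrt (∫ x, ‖u a x‖ ^ 2)) *
      Real.exp (-(4 * Real.pi ^ 2 * ν) * (t - a)) := mul_pos (by linarith) (Real.exp_pos _)
  linarith

/-- **Rebuild-time floor.** Under the hypotheses of `sqrt_integral_norm_sq_le_radius_sub_exp` with
`‖u(a)‖_{L²} < R_f`: for every `t ∈ [a, b]`,
`log ((R_f − ‖u(a)‖_{L²}) / (R_f − ‖u(t)‖_{L²})) ≤ 4π²ν·(t − a)` — climbing from the `L²`-level
`‖u(a)‖` to the level `‖u(t)‖` inside the absorbing ball costs at least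
`(4π²ν)⁻¹·ln((R_f − ‖u(a)‖)/(R_f − ‖u(t)‖))` units of time. -/
theorem log_le_four_pi_sq_mul_nu_mul_sub {S : Set ℝ} {ν : ℝ}
    {f u : ℝ → UnitAddTorus d → EuclideanSpace ℝ d} {p : ℝ → UnitAddTorus d → ℝ}
    (h : IsClassicalNSSolutionOn S ν f u p) (hS : Convex ℝ S) (hν : 0 < ν) {a b F : ℝ}
    (hab : Icc a b ⊆ S) (h0 : ∀ t ∈ Icc a b, HasZeroMean (u t))
    (hf : ∀ t ∈ Icc a b, IsSmooth (f t))
    (hF : ∀ t ∈ Icc a b, Real.sqrt (∫ x, ‖f t x‖ ^ 2) ≤ F)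
    (ha : Real.sqrt (∫ x, ‖u a x‖ ^ 2) < F / (4 * Real.pi ^ 2 * ν)) :
    ∀ t ∈ Icc a b, Real.log ((F / (4 * Real.pi ^ 2 * ν) - Real.sqrt (∫ x, ‖u a x‖ ^ 2)) /
        (F / (4 * Real.pi ^ 2 * ν) - Real.sqrt (∫ x, ‖u t x‖ ^ 2))) ≤
      4 * Real.pi ^ 2 * ν * (t - a) := by
  intro t ht
  have h1 := radius_sub_mul_exp_le_radius_sub h hS hν hab h0 hf hF ha.le t ht
  have h2 := sqrt_integral_norm_sq_lt_radius h hS hν hab h0 hf hF ha t ht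
  set Rf := F / (4 * Real.pi ^ 2 * ν)
  set La := Real.sqrt (∫ x, ‖u a x‖ ^ 2)
  set Lt := Real.sqrt (∫ x, ‖u t x‖ ^ 2)
  have hga : 0 < Rf - La := by linarith
  have hgt : 0 < Rf - Lt := by linarith
  rw [Real.log_le_iff_le_exp (div_pos hga hgt), div_le_iff₀ hgt]
  -- `(Rf − La) = (Rf − La)·e^{−κτ}·e^{κτ} ≤ (Rf − Lt)·e^{κτ}`
  have h3 : Real.exp (-(4 * Real.pi ^ 2 * ν) * (t - a)) * Real.exp (4 * Real.pi ^ 2 * ν * (t - a))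
      = 1 := by rw [← Real.exp_add]; simp
  calc Rf - La = (Rf - La) * Real.exp (-(4 * Real.pi ^ 2 * ν) * (t - a)) *
        Real.exp (4 * Real.pi ^ 2 * ν * (t - a)) := by rw [mul_assoc, h3, mul_one]
    _ ≤ (Rf - Lt) * Real.exp (4 * Real.pi ^ 2 * ν * (t - a)) :=
        mul_le_mul_of_nonneg_right h1 (Real.exp_pos _).le
    _ = Real.exp (4 * Real.pi ^ 2 * ν * (t - a)) * (Rf - Lt) := mul_comm _ _

/-- **Host form.** If the force satisfies `‖f(t)‖_{L²} ≤ 4π²ν·R_U` on `[a, b]` — e.g. the forced ABC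
host `f = (4π²ν)•U` (`AbcForcedSteadyState.isSteadyNSState_abcFlow`; `U` on the first Fourier shell,
`R_U = ‖U‖_{L²}`) — and `‖u(a)‖_{L²} ≤ R_U`, then
`‖u(t)‖_{L²} ≤ R_U − (R_U − ‖u(a)‖_{L²})·e^{−4π²ν(t−a)}` on `[a, b]`: the host's energy level is
approached at most at the Stokes rate of the host's shell. -/
theorem sqrt_integral_norm_sq_le_host_sub_exp {S : Set ℝ} {ν : ℝ}
    {f u : ℝ → UnitAddTorus d → EuclideanSpace ℝ d} {p : ℝ → UnitAddTorus d → ℝ}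
    (h : IsClassicalNSSolutionOn S ν f u p) (hS : Convex ℝ S) (hν : 0 < ν) {a b RU : ℝ}
    (hab : Icc a b ⊆ S) (h0 : ∀ t ∈ Icc a b, HasZeroMean (u t))
    (hf : ∀ t ∈ Icc a b, IsSmooth (f t))
    (hF : ∀ t ∈ Icc a b, Real.sqrt (∫ x, ‖f t x‖ ^ 2) ≤ 4 * Real.pi ^ 2 * ν * RU)
    (ha : Real.sqrt (∫ x, ‖u a x‖ ^ 2) ≤ RU) :
    ∀ t ∈ Icc a b, Real.sqrt (∫ x, ‖u t x‖ ^ 2) ≤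
      RU - (RU - Real.sqrt (∫ x, ‖u a x‖ ^ 2)) * Real.exp (-(4 * Real.pi ^ 2 * ν) * (t - a)) := by
  have hπν : 0 < 4 * Real.pi ^ 2 * ν := by positivity
  have hRU : 4 * Real.pi ^ 2 * ν * RU / (4 * Real.pi ^ 2 * ν) = RU := by field_simp
  have key := sqrt_integral_norm_sq_le_radius_sub_exp h hS hν hab h0 hf hF (by rw [hRU]; exact ha)
  rw [hRU] at key
  exact key

/-- **The two kernel-checked numbers of the Z4 dictionary sentence** (MODEL reading of the rebuild
floor in the cell's code units, rate `1/R = 1/300` per code time unit): rebuilding from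
`√(E/E_U) = 0.111` to `0.99` costs `≥ 300·ln(0.889/0.01) = 300·ln 88.9 > 1 247` code units (> 343 T_h),
and to `0.999` costs `≥ 300·ln 889 > 1 871` (> 515 T_h) — from `ln 88.9 ≥ 6 ln 2`, `ln 889 ≥ 9 ln 2` and
`ln 2 > 0.6931471803` (`Real.log_two_gt_d9`). WHAT THIS IS NOT: not NS — arithmetic. -/
theorem three_hundred_mul_log_gt :
    (1247 : ℝ) < 300 * Real.log (0.889 / 0.01) ∧ (1871 : ℝ) < 300 * Real.log (0.889 / 0.001) := by
  have h2 := Real.log_two_gt_d9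
  have h64 : Real.log 64 = 6 * Real.log 2 := by
    rw [show (64 : ℝ) = 2 ^ 6 by norm_num, Real.log_pow]; norm_num
  have h512 : Real.log 512 = 9 * Real.log 2 := by
    rw [show (512 : ℝ) = 2 ^ 9 by norm_num, Real.log_pow]; norm_num
  constructor
  · have hm : Real.log 64 ≤ Real.log (0.889 / 0.01) :=
      Real.log_le_log (by norm_num) (by norm_num)
    linarith
  · have hm : Real.log 512 ≤ Real.log (0.889 / 0.001) :=
      Real.log_le_log (by norm_num) (by norm_num)
    linarith

end Summit.NavierStokesRegularity.FluidComputer.ForcedEnergyRebuildFloor
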